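import Literature.Probability.RandomPlanarGeometry.SAWTriangularWordAutomata
import Literature.Probability.RandomPlanarGeometry.SAWFiniteMemory
import Mathlib.Analysis.SpecialFunctions.Pow.Real
import Std.Data.HashMap
import HarnessLib

/-!
# Finite-memory automata on the triangular lattice and certified upper bounds `μ(𝕋) ≤ N/D`

Topic `Literature/Probability/RandomPlanarGeometry` (continues `SAWTriangularWordAutomata.lean`; the
triangular-lattice twin of `SAWFiniteMemory.lean`). Pönitz and Tittmann (2000) bound a connective constant
from above by the growth rate of the *walks with memory `k`* (no loop of length `≤ k`), computed as the largest
eigenvalue of an automatically generated automaton whose states are the walk suffixes that can still be closed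
to a loop within the memory; Alm (1993, 2005) obtained the printed upper bounds for the triangular lattice by
related finite-section methods (`μ(𝕋) < 4.278`, resp. `μ(𝕋) < 4.251419`). This file makes the
Pönitz–Tittmann bound kernel-checkable on `𝕋`, with the graph distance of the triangular lattice
`dist_𝕋((x,y),(x',y')) = max(|Δx|, |Δy|, |Δx + Δy|) = (|Δx| + |Δy| + |Δx + Δy|)/2` in place of the
`ℓ¹`-distance of `ℤ²`:

* `TriFiniteMemory.ptStep K` — the automaton on six-letter step words (`SAWTriangularWords.lean`): append the
  letter, kill the run if the suffix closes a loop, otherwise truncate to the longest suffix `b` with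
  `|b| + dist_𝕋(start b, end b) ≤ K`; **every self-avoiding word survives** (`run_ne_none_of_isTriSAW`);
* `TriFiniteMemory.check K N D iters` — an executable certificate check: an (untrusted) breadth-first search
  enumerates the reachable states and an integer power iteration (`FiniteMemory.powerIter` of the `ℤ²` file)
  proposes a weight `v`; the (verified) function `verify` then checks closure and the Collatz–Wielandt
  inequalities `D Σ_d v(ptStep a d) ≤ N v(a)`, i.e. a `TriWordAutomaton.Certificate`;
* `triSawCount_mul_pow_le_of_check : check K N D iters = true → c_n(𝕋) Dⁿ ≤ Nⁿ 2⁴¹`,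
  `logMuTri_le_log_div_of_check` and **`exp_logMuTri_le_of_check : check K N D iters = true → μ(𝕋) ≤ N/D`**
  (`μ(𝕋) = exp logMuTri`, `SAWSquareLtTriangular.lean`).

The evaluations (one `native_decide` each, computational class) live in `SAWTriangularFiniteMemory11.lean`
(`K = 11`, `293 767` states, `μ(𝕋) ≤ 4.281`) and, symmetry-reduced, in `SAWTriangularFiniteMemorySymm.lean` ff.

## References

* A. Pönitz, P. Tittmann, *Improved upper bounds for self-avoiding walks in ℤᵈ*, Electron. J.
  Combin. 7 (2000) R21, §2 (the automaton), §3 (eigenvalue bound) [PonitzTittmann2000].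
* S. E. Alm, *Upper bounds for the connective constant of self-avoiding walks*, Combin. Probab.
  Comput. 2 (1993) 115–136 [Alm1993]; S. E. Alm, *Upper and lower bounds for the connective constants of
  self-avoiding walks on the Archimedean and Laves lattices*, J. Phys. A 38 (2005) 2055–2080, §5.5.1.
* N. Madras, G. Slade, *The Self-Avoiding Walk* (1993), §1.2 (`μ = infₙ cₙ^{1/n}`) [MadrasSlade1993].
-/

open Finset Filter Topology Literature.Probability.LatticeModels
open scoped BigOperators

namespace Literature.Probability.RandomPlanarGeometry.SAW

namespace TriFiniteMemory

/-! ### Integer-pair coordinates (the executable model) -/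

/-- The pair of coordinates of a site of `ℤ²` (the vertex set of `𝕋`). [cite: PonitzTittmann2000, §2] -/
def toPair (x : Site 2) : ℤ × ℤ := (x 0, x 1)

/-- `toPair` is injective. [cite: PonitzTittmann2000, §2] -/
theorem toPair_injective : Function.Injective toPair := by
  intro x y h
  simp only [toPair, Prod.mk.injEq] at h
  funext i
  fin_cases i
  · exact h.1
  · exact h.2

/-- Move the pair `p` by one step of `𝕋` in direction `d` (a six-way branch on `d`, the fast form of
`p + vec d` for the executable model). [cite: PonitzTittmann2000, §2] -/
def pxy (d : TriStep) (p : ℤ × ℤ) : ℤ × ℤ :=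
  match d.val with
  | 0 => (p.1 + 1, p.2)
  | 1 => (p.1, p.2 + 1)
  | 2 => (p.1 - 1, p.2 + 1)
  | 3 => (p.1 - 1, p.2)
  | 4 => (p.1, p.2 - 1)
  | _ => (p.1 + 1, p.2 - 1)

/-- `pxy d p = p + (dx d, dy d)`. [cite: PonitzTittmann2000, §2] -/
theorem pxy_eq (d : TriStep) (p : ℤ × ℤ) : pxy d p = (p.1 + TriStep.dx d, p.2 + TriStep.dy d) := by
  obtain ⟨x, y⟩ := p
  fin_cases d <;> simp [pxy, TriStep.dx, TriStep.dy] <;> ring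

/-- `toPair (x + vec d) = pxy d (toPair x)`. [cite: PonitzTittmann2000, §2] -/
@[simp] theorem toPair_add_vec (x : Site 2) (d : TriStep) :
    toPair (x + TriStep.vec d) = pxy d (toPair x) := by
  rw [pxy_eq]
  simp [toPair]

/-- Endpoint of a word in pair coordinates (left fold). [cite: PonitzTittmann2000, §2] -/
def pEnd (a : List TriStep) : ℤ × ℤ := a.foldl (fun p d => pxy d p) (0, 0)

/-- The visited vertices of a word in pair coordinates (`List.scanl`). [cite: PonitzTittmann2000, §2] -/
def pVerts (a : List TriStep) : List (ℤ × ℤ) := a.scanl (fun p d => pxy d p) (0, 0)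

/-- **The graph norm of the triangular lattice** in lattice coordinates:
`‖(a, b)‖_𝕋 = max(|a|, |b|, |a + b|) = (|a| + |b| + |a + b|)/2` (the steps are `±(1,0)`, `±(0,1)`,
`±(1,−1)`; the sum form is the one used). Only its invariance under the lattice symmetries is ever used
(in the symmetry-reduced check); here it merely defines the truncation rule. [cite: PonitzTittmann2000, §2] -/
def normT (v : ℤ × ℤ) : ℕ := (v.1.natAbs + v.2.natAbs + (v.1 + v.2).natAbs) / 2

/-- `dist_𝕋(p, q) = ‖p − q‖_𝕋`. [cite: PonitzTittmann2000, §2] -/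
def distT (p q : ℤ × ℤ) : ℕ := normT (p.1 - q.1, p.2 - q.2)

/-- Folding the steps of `a` from `toPair x` reaches `toPair (x + triWEnd a)`. [cite: PonitzTittmann2000, §2] -/
theorem foldl_pxy_eq (a : List TriStep) (x : Site 2) :
    a.foldl (fun p d => pxy d p) (toPair x) = toPair (x + triWEnd a) := by
  induction a generalizing x with
  | nil => simp
  | cons d a ih =>
    rw [List.foldl_cons, ← toPair_add_vec, ih, triWEnd_cons, add_assoc]

/-- `pEnd a = toPair (triWEnd a)`. [cite: PonitzTittmann2000, §2] -/
theorem pEnd_eq (a : List TriStep) : pEnd a = toPair (triWEnd a) := by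
  have := foldl_pxy_eq a 0
  rw [zero_add] at this
  rw [← this, pEnd]
  rfl

/-- The vertices of `pVerts a` are the `toPair (triTraj a i)`, `i ≤ |a|`. [cite: PonitzTittmann2000, §2] -/
theorem mem_pVerts_iff (a : List TriStep) (q : ℤ × ℤ) :
    q ∈ pVerts a ↔ ∃ i ≤ a.length, q = toPair (triTraj a i) := by
  rw [pVerts, FiniteMemory.mem_scanl_iff]
  refine exists_congr fun i => and_congr_right fun _ => ?_
  have := foldl_pxy_eq (a.take i) 0
  rw [zero_add] at this
  rw [triTraj, ← this]
  rfl

/-! ### The Pönitz–Tittmann automaton on `𝕋` -/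

/-- **One step of the memory-`K` automaton on the triangular lattice** (Pönitz–Tittmann 2000, §2, with the
graph distance of `𝕋`): from the state `a` (a step word, the remembered suffix) on the letter `d`, kill the
run if the new endpoint is a vertex of `a` (a loop of length `≤ K` closes), otherwise keep the longest suffix
`b` of `a ++ [d]` with `|b| + dist_𝕋(start b, end b) ≤ K`. [cite: PonitzTittmann2000, §2] -/
def ptStep (K : ℕ) (a : List TriStep) (d : TriStep) : Option (List TriStep) :=
  let e := pxy d (pEnd a)
  let vs := pVerts a
  if e ∈ vs then none
  else
    let L := a.length + 1
    let j := ((vs.zipIdx).takeWhile fun pi => decide (K < (L - pi.2) + distT pi.1 e)).length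
    some ((a ++ [d]).drop j)

/-- The new state is a suffix of the old state with the letter appended. [cite: PonitzTittmann2000, §2] -/
theorem ptStep_suffix {K : ℕ} {a b : List TriStep} {d : TriStep} (h : ptStep K a d = some b) :
    b <:+ a ++ [d] := by
  unfold ptStep at h
  simp only at h
  split_ifs at h
  rw [Option.some.injEq] at h
  rw [← h]
  exact List.drop_suffix _ _

/-- A self-avoiding input is never killed: if `a ++ [d]` is self-avoiding then `ptStep K a d`
is defined. [cite: PonitzTittmann2000, §2] -/
theorem ptStep_ne_none {K : ℕ} {a : List TriStep} {d : TriStep} (h : IsTriSAW (a ++ [d])) :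
    ptStep K a d ≠ none := by
  unfold ptStep
  simp only
  split_ifs with hmem
  · exfalso
    obtain ⟨i, hi, he⟩ := (mem_pVerts_iff a _).1 hmem
    rw [pEnd_eq, ← toPair_add_vec] at he
    have he' := toPair_injective he
    have h1 : triTraj (a ++ [d]) (a.length + 1) = triWEnd a + TriStep.vec d := by
      rw [triTraj_append_right a [d] 1]
      simp [triTraj]
    have h2 : triTraj (a ++ [d]) i = triTraj a i := triTraj_append_left a [d] hi
    have hinj := (isTriSAW_iff_injOn _).1 h
    have := hinj (show a.length + 1 ∈ {j | j ≤ (a ++ [d]).length} by simp)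
      (show i ∈ {j | j ≤ (a ++ [d]).length} by simp; omega) (by rw [h1, h2, he'])
    omega
  · exact Option.some_ne_none _

/-- **Every self-avoiding word survives the memory-`K` automaton**, and its state is a suffix of
the word read. [cite: PonitzTittmann2000, §2] -/
theorem run_eq_some_of_isTriSAW (K : ℕ) (w : List TriStep) (h : IsTriSAW w) :
    ∃ a, TriWordAutomaton.run (ptStep K) w = some a ∧ a <:+ w := by
  induction w using List.reverseRecOn with
  | nil => exact ⟨[], rfl, List.suffix_refl _⟩
  | append_singleton w d ih =>
    have hw : IsTriSAW w := by simpa using h.take w.length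
    obtain ⟨a, ha, hsuf⟩ := ih hw
    obtain ⟨t, rfl⟩ := hsuf
    have had : IsTriSAW (a ++ [d]) := by
      have := h.drop t.length
      simpa using this
    cases hs : ptStep K a d with
    | none => exact absurd hs (ptStep_ne_none had)
    | some b =>
      refine ⟨b, by rw [TriWordAutomaton.run_append_singleton, ha, Option.bind_some, hs], ?_⟩
      exact (ptStep_suffix hs).trans ⟨t, (List.append_assoc t a [d]).symm⟩

/-- Self-avoiding words are live for `ptStep K`. [cite: PonitzTittmann2000, §2] -/
theorem run_ne_none_of_isTriSAW (K : ℕ) (w : List TriStep) (h : IsTriSAW w) :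
    TriWordAutomaton.run (ptStep K) w ≠ none := by
  obtain ⟨a, ha, -⟩ := run_eq_some_of_isTriSAW K w h
  rw [ha]
  exact Option.some_ne_none a

/-! ### The certificate: untrusted search -/

/-- Breadth-first enumeration of the states reachable from `[]` (fuelled; untrusted — only its
output is checked). [cite: PonitzTittmann2000, §2] -/
def bfs (K : ℕ) : Array (List TriStep) × Std.HashMap (List TriStep) ℕ := Id.run do
  let mut states : Array (List TriStep) := #[[]]
  let mut idx : Std.HashMap (List TriStep) ℕ := (Std.HashMap.emptyWithCapacity 1000000).insert [] 0
  let mut i := 0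
  let mut fuel := 20000000
  while i < states.size && fuel > 0 do
    fuel := fuel - 1
    let a := states[i]!
    for d in List.finRange 6 do
      match ptStep K a d with
      | none => pure ()
      | some b =>
        if !idx.contains b then
          idx := idx.insert b states.size
          states := states.push b
    i := i + 1
  return (states, idx)

/-- Successor indices of every state (untrusted). [cite: PonitzTittmann2000, §2] -/
def transTable (K : ℕ) (states : Array (List TriStep)) (idx : Std.HashMap (List TriStep) ℕ) :
    Array (Array ℕ) :=
  states.map fun a => Id.run do
    let mut acc : Array ℕ := #[]
    for d in List.finRange 6 do
      match ptStep K a d with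
      | none => pure ()
      | some b => acc := acc.push (idx.getD b 0)
    return acc

/-- The search: states, index, proposed weights (untrusted; the integer power iteration is the `ℤ²`
file's `FiniteMemory.powerIter`). [cite: PonitzTittmann2000, §2] -/
def search (K iters : ℕ) : Array (List TriStep) × Std.HashMap (List TriStep) ℕ × Array ℕ :=
  let (states, idx) := bfs K
  (states, idx, FiniteMemory.powerIter (transTable K states idx) iters)

/-! ### The certificate: verified check -/

/-- The weight function encoded by the arrays: `v[idx[a]]` (`0` off the table). [cite: PonitzTittmann2000, §2] -/
def weightOf (idx : Std.HashMap (List TriStep) ℕ) (v : Array ℕ) (a : List TriStep) : ℕ :=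
  match idx[a]? with
  | none => 0
  | some j => v[j]?.getD 0

/-- Check of the state number `i`: consistent index, positive weight, successors in the table,
Collatz–Wielandt inequality. [cite: PonitzTittmann2000, §3] -/
def verifyState (K N D : ℕ) (states : Array (List TriStep)) (idx : Std.HashMap (List TriStep) ℕ)
    (v : Array ℕ) (i : ℕ) : Bool :=
  match states[i]?, v[i]? with
  | some a, some vi =>
    decide (idx[a]? = some i) && decide (1 ≤ vi) &&
      (List.finRange 6).all (fun d =>
        match ptStep K a d with
        | none => true
        | some b =>
          match idx[b]? with
          | none => false
          | some j => decide (states[j]? = some b)) &&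
      decide (D * (List.ofFn fun d : TriStep => ((ptStep K a d).map (weightOf idx v)).getD 0).sum
        ≤ N * vi)
  | _, _ => false

/-- The verified part of the certificate check. [cite: PonitzTittmann2000, §3] -/
def verify (K N D : ℕ) (states : Array (List TriStep)) (idx : Std.HashMap (List TriStep) ℕ)
    (v : Array ℕ) : Bool :=
  decide (states[0]? = some []) && decide (weightOf idx v [] ≤ 2 ^ 41) &&
    (List.range states.size).all (verifyState K N D states idx v)

/-- **The certificate check** `check K N D iters`: search, then verify. Only ever evaluated by
`native_decide` (see `SAWTriangularFiniteMemory11.lean`). [cite: PonitzTittmann2000, §3] -/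
@[irreducible] def check (K N D iters : ℕ) : Bool :=
  let r := search K iters
  verify K N D r.1 r.2.1 r.2.2

/-- **Soundness of `verify`**: a successful check yields a Collatz–Wielandt certificate for
`ptStep K` on the set of tabulated states, with `v([]) ≤ 2⁴¹`. [cite: PonitzTittmann2000, §3] -/
theorem certificate_of_verify {K N D : ℕ} {states : Array (List TriStep)}
    {idx : Std.HashMap (List TriStep) ℕ} {v : Array ℕ} (h : verify K N D states idx v = true) :
    TriWordAutomaton.Certificate (ptStep K) {a | ∃ i < states.size, states[i]? = some a}
      (weightOf idx v) N D ∧ weightOf idx v [] ≤ 2 ^ 41 := by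
  simp only [verify, Bool.and_eq_true, decide_eq_true_eq, List.all_eq_true, List.mem_range] at h
  obtain ⟨⟨h0, hroot⟩, hall⟩ := h
  -- unpack the check of a tabulated state
  have key : ∀ a : List TriStep, ∀ i < states.size, states[i]? = some a →
      idx[a]? = some i ∧ 1 ≤ weightOf idx v a ∧
      (∀ d b, ptStep K a d = some b → ∃ j < states.size, states[j]? = some b) ∧
      D * ∑ d : TriStep, ((ptStep K a d).map (weightOf idx v)).getD 0 ≤ N * weightOf idx v a := by
    intro a i hi ha
    have hs := hall i hi
    unfold verifyState at hs
    rw [ha] at hs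
    cases hv : v[i]? with
    | none => simp [hv] at hs
    | some vi =>
      simp only [hv, Bool.and_eq_true, decide_eq_true_eq, List.all_eq_true] at hs
      obtain ⟨⟨⟨hidx, hvi⟩, hsucc⟩, hcw⟩ := hs
      have hw : weightOf idx v a = vi := by simp [weightOf, hidx, hv]
      refine ⟨hidx, hw ▸ hvi, fun d b hb => ?_, ?_⟩
      · have := hsucc d (List.mem_finRange d)
        rw [hb] at this
        cases hj : idx[b]? with
        | none => simp [hj] at this
        | some j =>
          simp only [hj, decide_eq_true_eq] at this
          exact ⟨j, (Array.getElem?_eq_some_iff.1 this).1, this⟩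
      · rw [hw, ← List.sum_ofFn]
        exact hcw
  refine ⟨⟨?_, ?_, ?_, ?_⟩, hroot⟩
  · exact ⟨0, (Array.getElem?_eq_some_iff.1 h0).1, h0⟩
  · rintro a ⟨i, hi, ha⟩ d b hb
    exact (key a i hi ha).2.2.1 d b hb
  · rintro a ⟨i, hi, ha⟩
    exact (key a i hi ha).2.1
  · rintro a ⟨i, hi, ha⟩
    exact (key a i hi ha).2.2.2

/-- **`c_n(𝕋) · Dⁿ ≤ Nⁿ · 2⁴¹`** from a successful certificate check. [cite: PonitzTittmann2000, §3] -/
theorem triSawCount_mul_pow_le_of_check {K N D iters : ℕ} (h : check K N D iters = true) (n : ℕ) :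
    triSawCount n * D ^ n ≤ N ^ n * 2 ^ 41 := by
  rw [check] at h
  obtain ⟨hc, hroot⟩ := certificate_of_verify h
  exact le_trans (TriWordAutomaton.triSawCount_mul_pow_le hc (run_ne_none_of_isTriSAW K) n)
    (Nat.mul_le_mul_left _ hroot)

/-! ### The bound on the connective constant -/

/-- A successful check with `D > 0` has `N > 0` (since `c_1(𝕋) ≥ 1`). [cite: PonitzTittmann2000, §2] -/
theorem pos_of_check {K N D iters : ℕ} (h : check K N D iters = true) (hD : 0 < D) : 0 < N := by
  have h1 := triSawCount_mul_pow_le_of_check h 1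
  have hc : 1 ≤ triSawCount 1 := one_le_triSawCount 1
  rcases Nat.eq_zero_or_pos N with hN | hN
  · subst hN
    simp only [pow_one, zero_mul, nonpos_iff_eq_zero, mul_eq_zero] at h1
    omega
  · exact hN

/-- **`logMuTri ≤ log (N/D)`** from a successful certificate check
(`c_{n+1}(𝕋) ≤ (2⁴¹ N/D) · (N/D)ⁿ` and `logMuTri_le_log_of_succ_le`). [cite: PonitzTittmann2000, §3] -/
theorem logMuTri_le_log_div_of_check {K N D iters : ℕ} (h : check K N D iters = true) (hD : 0 < D) :
    logMuTri ≤ Real.log ((N : ℝ) / D) := by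
  have hN : 0 < N := pos_of_check h hD
  have hNDpos : (0 : ℝ) < (N : ℝ) / D := by positivity
  refine logMuTri_le_log_of_succ_le (A := (2 : ℝ) ^ 41 * ((N : ℝ) / D)) (B := (N : ℝ) / D)
    (by positivity) hNDpos fun n => ?_
  have h3 := triSawCount_mul_pow_le_of_check h (n + 1)
  have h4 : (triSawCount (n + 1) : ℝ) * (D : ℝ) ^ (n + 1) ≤ (N : ℝ) ^ (n + 1) * (2 : ℝ) ^ 41 := by
    exact_mod_cast h3
  have hDpos : (0 : ℝ) < (D : ℝ) ^ (n + 1) := by positivity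
  have e : (2 : ℝ) ^ 41 * ((N : ℝ) / D) * ((N : ℝ) / D) ^ n = (N : ℝ) ^ (n + 1) * 2 ^ 41 / (D : ℝ) ^ (n + 1) := by
    rw [div_pow]
    field_simp
    ring
  rw [e, le_div_iff₀ hDpos]
  exact h4

/-- **`μ(𝕋) ≤ N/D` from a successful certificate check**: `exp logMuTri ≤ N/D`
(`exp logMuTri = μ(𝕋)` by `tendsto_log_triSawCount_div`). [cite: PonitzTittmann2000, §3] -/
theorem exp_logMuTri_le_of_check {K N D iters : ℕ} (h : check K N D iters = true) (hD : 0 < D) :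
    Real.exp logMuTri ≤ (N : ℝ) / D := by
  have hN : 0 < N := pos_of_check h hD
  have hNDpos : (0 : ℝ) < (N : ℝ) / D := by positivity
  calc Real.exp logMuTri ≤ Real.exp (Real.log ((N : ℝ) / D)) :=
        Real.exp_le_exp.2 (logMuTri_le_log_div_of_check h hD)
    _ = (N : ℝ) / D := Real.exp_log hNDpos

end TriFiniteMemory

end Literature.Probability.RandomPlanarGeometry.SAW
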